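import Summits.BirchSwinnertonDyer.BirchSwinnertonDyer.Theorems.SignedLowerHalvesKobayashiLowerHalfLargeImagePairedDescent
import Literature.NumberTheory.QuadraticFields.ImaginaryQuadraticPrescribedSplittingInert
import HarnessLib

/-!
# Route `SignedLowerHalves`, crux `KobayashiLowerHalfLargeImage` (item stmt-BirchSwinnertonDyer-19001):
# the CARTAN FIELD of line `cartan-chamber` EXISTS (its stub `stub_cartanField` discharged), and its
# paired door on named published inputs

Lead `bsd-line-slh-p1` gen 11 (a `--supports stmt-BirchSwinnertonDyer-19001 --as helper` file; closes
nothing; line of record `kurihara_rigidity` untouched). The crux-ideate line `cartan-chamber`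
(`Cruxes/KobayashiLowerHalfLargeImage/Lines/cartan_chamber.lean`, k1 g10, NOT registered per W-79) runs
Wan's two-variable Greenberg road over an imaginary quadratic «Cartan field» `K = ℚ(√d)` in which the
curve's tame supercuspidal prime `q` is INERT and `p`, `2` and every other odd bad prime SPLIT. Two of
its six stubs are published-input-sized; this file settles them in the permanent tree, with the line's
`def … : Prop` bodies spelled VERBATIM (Cruxes modules are not importable):

* §1 `exists_cartanDiscriminant_arith` — the arithmetic core: for primes `p ≠ q`, `q` odd, and
  `n, m ≠ 0` there is `d = -r < 0` (`r` prime) squarefree, `d ≡ 1 (mod 8)`, prime to `n`, a square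
  mod `p`, a NON-square mod `q`, a square mod every odd prime `ℓ ∣ m`, `ℓ ≠ q`. Proof = the tree's
  Dirichlet-plus-CRT theorem `Quadratic.exists_prime_prescribed_residues` (split set
  `S = ({p} ∪ primes(m)) \ {q}`, inert set `T = {q}`): `r ≡ 7 (mod 8)`, `r ≡ -1 (mod ℓ)` on `S`,
  `-r` a non-residue mod `q`, `r > n`.
* §2 `exists_cartanDiscriminant` (any elliptic `W`, primes `p ≠ q`, `q ≠ 2`) and
  `cartanFieldStatement` = the body of the line's `CartanFieldStatement` VERBATIM (hypotheses
  `W.HasGoodReductionAtPrime p` and the unfolded `IsTameSCPrime W q`; conclusion the unfolded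
  `IsCartanDiscriminant W p q d`) — so a registered `cartan_chamber` closes `stub_cartanField` by
  `exact Theorems.CartanChamber.cartanFieldStatement`. Only `p ≠ q` (good vs additive) and `q ≠ 2`
  (`5 ≤ q`) of the tame-supercuspidal hypothesis are used.
* §3 `not_dvd_two_mul_of_isCoprime` (the door's side condition `p ∤ 2d` from `(d, pN) = 1`, `p ≥ 5`)
  and `pairedDoorCartanStatement_of_facts` = the body of the line's `PairedDoorCartanStatement`
  GRANTED the named published inputs it was always meant to consume (Kobayashi 2003 Thm 1.2 `h12`,
  Thm 4.1 `h41`, Pollack `hPollack`, modularity `hmod`, period unit `h5`/`h3`, Wuthrich L. 20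
  `hL20`) — one application of the landed k3-c3 door `X7.kobayashiLowerDivisibility_of_paired_twist`.

WHAT THIS IS NOT: not the line's engine (`stub_greenbergCartan`, the two-variable Greenberg
containment over `K` + an unprinted anticyclotomic `μ`-lemma at non-split-Cartan level — OPEN) and
not a claim about any X7 pair; the crux, the route and BSD are not proved by any of this.

References: Dirichlet's theorem (Mathlib `Nat.forall_exists_prime_gt_and_eq_mod`, via the tree's
`Literature/NumberTheory/QuadraticFields/ImaginaryQuadraticPrescribedSplittingInert.lean`);
[Kobayashi2003] Thm 1.2, 4.1; [Pollack2003] Cor. 5.11; [SilvermanAEC2009] X.5 Cor. 5.4.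
-/

set_option autoImplicit false
set_option linter.dupNamespace false

noncomputable section

open scoped Classical MatrixGroups ModularForm

open CongruenceSubgroup WeierstrassCurve Literature.NumberTheory.EllipticCurves
  Literature.NumberTheory.EllipticCurves.ModularForms
  Literature.NumberTheory.EllipticCurves.Rank1Residual
  Literature.NumberTheory.EllipticCurves.Rank1Residual.Typed
  Literature.NumberTheory.EllipticCurves.Kobayashi2003 ZpExtension
  Summit.BirchSwinnertonDyer.Rank1Residual.Supersingular

namespace Summit.BirchSwinnertonDyer.BirchSwinnertonDyer.Theorems

namespace CartanChamber

/-! ### §1 The arithmetic core: a negative prime discriminant with prescribed residues -/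

/-- **Arithmetic core of the Cartan field.** For primes `p ≠ q` with `q` odd and natural numbers
`n, m ≠ 0` there is an integer `d < 0`, squarefree, `d ≡ 1 (mod 8)`, coprime to `n`, which is a
square mod `p`, a NON-square mod `q`, and a square mod every odd prime `ℓ ∣ m` other than `q`.
Take `d = -r` with `r` the prime of `Quadratic.exists_prime_prescribed_residues` for the split set
`S = ({p} ∪ primes(m)) \ {q}` and the inert set `{q}`, beyond the bound `n`: `r ≡ 7 (mod 8)`,
`r ≡ -1 (mod ℓ)` for odd `ℓ ∈ S` (so `d ≡ 1`), `-r` a non-residue mod `q`, and `r > n` prime, hence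
prime to `n`. [cite: IrelandRosen1990, Ch. 16 §1 Thm. 1 (Dirichlet's theorem on primes in arithmetic progressions)] -/
theorem exists_cartanDiscriminant_arith {p q : ℕ} (hp : p.Prime) (hq : q.Prime) (hq2 : q ≠ 2)
    (hpq : p ≠ q) {n m : ℕ} (hn : n ≠ 0) (hm : m ≠ 0) :
    ∃ d : ℤ, d < 0 ∧ Squarefree d ∧ d % 8 = 1 ∧ IsCoprime d (n : ℤ) ∧
      IsSquare ((d : ZMod p)) ∧ ¬ IsSquare ((d : ZMod q)) ∧
      ∀ ℓ : ℕ, ℓ.Prime → ℓ ∣ m → ℓ ≠ q → ℓ ≠ 2 → IsSquare ((d : ZMod ℓ)) := by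
  classical
  -- split set: `p` and the primes of `m`, minus `q`; inert set: `{q}`
  set S : Finset ℕ := (insert p m.primeFactors).erase q with hS_def
  have hS : ∀ ℓ ∈ S, ℓ.Prime := by
    intro ℓ hℓ
    rw [hS_def, Finset.mem_erase, Finset.mem_insert] at hℓ
    rcases hℓ.2 with h | h
    · exact h ▸ hp
    · exact Nat.prime_of_mem_primeFactors h
  have hT : ∀ ℓ ∈ ({q} : Finset ℕ), ℓ.Prime := by
    intro ℓ hℓ
    rw [Finset.mem_singleton] at hℓ
    exact hℓ ▸ hq
  have hST : Disjoint S ({q} : Finset ℕ) := by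
    rw [Finset.disjoint_singleton_right, hS_def]
    exact Finset.notMem_erase q _
  obtain ⟨r, hr, hrn, -, -, -, h8, -, hSres, hTres⟩ :=
    Literature.NumberTheory.QuadraticFields.Quadratic.exists_prime_prescribed_residues S {q} hS hT
      hST n
  have h2T : (2 : ℕ) ∉ ({q} : Finset ℕ) := by
    rw [Finset.mem_singleton]
    exact fun h ↦ hq2 h.symm
  have hr8 : r % 8 = 7 := h8 h2T
  -- `d = -r ≡ 1` at every odd prime of `S`
  have hres : ∀ ℓ ∈ S, ℓ ≠ 2 → ((-(r : ℤ) : ℤ) : ZMod ℓ) = 1 := by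
    intro ℓ hℓ hℓ2
    rw [Int.cast_neg, Int.cast_natCast, hSres ℓ hℓ hℓ2, neg_neg]
  refine ⟨-(r : ℤ), by have := hr.one_lt; omega, ?_, by omega, ?_, ?_, ?_, ?_⟩
  · -- squarefree
    rw [← Int.squarefree_natAbs]
    simpa using hr.squarefree
  · -- coprime to `n`: `r` is a prime beyond `n`
    have hrn' : ¬ r ∣ n := fun h ↦ by
      have := Nat.le_of_dvd (Nat.pos_of_ne_zero hn) h
      omega
    exact (Nat.isCoprime_iff_coprime.mpr ((Nat.Prime.coprime_iff_not_dvd hr).mpr hrn')).neg_left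
  · -- a square mod `p`
    by_cases hp2 : p = 2
    · subst hp2
      have h1 : ((-(r : ℤ) : ℤ) : ZMod 2) = ((1 : ℤ) : ZMod 2) := by
        rw [ZMod.intCast_eq_intCast_iff']
        omega
      exact ⟨1, by rw [h1, Int.cast_one, mul_one]⟩
    · have hpS : p ∈ S := by
        rw [hS_def, Finset.mem_erase]
        exact ⟨hpq, Finset.mem_insert_self _ _⟩
      exact ⟨1, by rw [hres p hpS hp2, mul_one]⟩
  · -- a non-square mod `q`
    rw [Int.cast_neg, Int.cast_natCast]
    exact (hTres q (Finset.mem_singleton_self q) hq2).2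
  · -- a square mod the odd primes of `m` other than `q`
    intro ℓ hℓ hℓm hℓq hℓ2
    have hℓS : ℓ ∈ S := by
      rw [hS_def, Finset.mem_erase, Finset.mem_insert, Nat.mem_primeFactors]
      exact ⟨hℓq, Or.inr ⟨hℓ, hℓm, hm⟩⟩
    exact ⟨1, by rw [hres ℓ hℓS hℓ2, mul_one]⟩

/-! ### §2 The Cartan field of a curve: `stub_cartanField` of line `cartan-chamber`, discharged -/

section Curve

variable (W : WeierstrassCurve ℚ) [W.IsElliptic]

/-- **A Cartan discriminant exists** for every elliptic `W/ℚ` and primes `p ≠ q`, `q` odd: an integer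
`d < 0`, squarefree, `d ≡ 1 (mod 8)`, prime to `p·N_W`, with `p` SPLIT (`d` a square mod `p`), `q`
INERT (`d` a non-square mod `q`) and every odd prime `ℓ ≠ q` of the conductor SPLIT in `ℚ(√d)` —
the conjuncts of the line's `IsCartanDiscriminant W p q d`, verbatim. (`N_W > 0` by
`conductorNorm_pos_holds`.) [cite: IrelandRosen1990, Ch. 16 §1 Thm. 1 (Dirichlet's theorem on primes in arithmetic progressions)] -/
theorem exists_cartanDiscriminant (p q : ℕ) [Fact p.Prime] [Fact q.Prime] (hpq : p ≠ q)
    (hq2 : q ≠ 2) :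
    ∃ d : ℤ, d < 0 ∧ Squarefree d ∧ d % 8 = 1 ∧
      IsCoprime d ((p * W.conductorNorm ℤ : ℕ) : ℤ) ∧
      IsSquare ((d : ZMod p)) ∧ ¬ IsSquare ((d : ZMod q)) ∧
      ∀ ℓ : ℕ, ℓ.Prime → ℓ ∣ W.conductorNorm ℤ → ℓ ≠ q → ℓ ≠ 2 → IsSquare ((d : ZMod ℓ)) := by
  have hN : W.conductorNorm ℤ ≠ 0 := (W.conductorNorm_pos_holds).ne'
  have hp : p.Prime := Fact.out
  exact exists_cartanDiscriminant_arith hp Fact.out hq2 hpq (mul_ne_zero hp.ne_zero hN) hN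

/-- **`stub_cartanField` of line `cartan-chamber`, DISCHARGED** — the body of the line's
`CartanFieldStatement` VERBATIM (`IsTameSCPrime W q` and `IsCartanDiscriminant W p q d` unfolded):
a globally minimal curve with good reduction at `p` and a tame supercuspidal prime `q` (`5 ≤ q`,
additive, potentially good, `12 / gcd(12, v_q Δ_min) ∤ q - 1`) has a Cartan discriminant. Of the
supercuspidal hypothesis only `q ≠ 2` and `q ≠ p` (good at `p`, not good at `q`) are used.
[cite: IrelandRosen1990, Ch. 16 §1 Thm. 1 (Dirichlet's theorem on primes in arithmetic progressions)]
[cite: Serre1972, §5.6 (pp. 311–313)] -/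
theorem cartanFieldStatement :
    ∀ (W : WeierstrassCurve ℚ) [W.IsElliptic] [W.IsGloballyMinimal] (p q : ℕ) [Fact p.Prime]
      [Fact q.Prime], W.HasGoodReductionAtPrime p →
      (5 ≤ q ∧ ¬ W.HasGoodReductionAtPrime q ∧ ¬ W.HasMultiplicativeReductionAtPrime q ∧
        0 ≤ padicValRat q W.j ∧
        ¬ (12 / Nat.gcd 12 (padicValInt q W.minimalDiscriminantInt) ∣ q - 1)) →
      ∃ d : ℤ, d < 0 ∧ Squarefree d ∧ d % 8 = 1 ∧
        IsCoprime d ((p * W.conductorNorm ℤ : ℕ) : ℤ) ∧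
        IsSquare ((d : ZMod p)) ∧ ¬ IsSquare ((d : ZMod q)) ∧
        ∀ ℓ : ℕ, ℓ.Prime → ℓ ∣ W.conductorNorm ℤ → ℓ ≠ q → ℓ ≠ 2 → IsSquare ((d : ZMod ℓ)) := by
  intro W _ _ p q _ _ hgood hsc
  refine exists_cartanDiscriminant W p q ?_ (by have := hsc.1; omega)
  rintro rfl
  exact hsc.2.1 hgood

end Curve

/-! ### §3 The paired door at a Cartan twist, on the named published inputs -/

/-- **Side condition of the door.** A Cartan discriminant is prime to `p·N`, hence `p ∤ 2d` for
`p ≥ 5`. (Re-proof of the line's anchor `not_dvd_two_mul_of_isCartanDiscriminant` against the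
unfolded coprimality conjunct.) [cite: SilvermanAEC2009, X.5 Cor. 5.4] -/
theorem not_dvd_two_mul_of_isCoprime {p : ℕ} (hp : p.Prime) (hp5 : 5 ≤ p) {d : ℤ} {N : ℕ}
    (hd : IsCoprime d ((p * N : ℕ) : ℤ)) : ¬ (p : ℤ) ∣ 2 * d := by
  intro h
  have hpZ : Prime (p : ℤ) := Nat.prime_iff_prime_int.mp hp
  have hp2 : ¬ (p : ℤ) ∣ 2 := by
    intro h2
    have hle := Int.le_of_dvd (by norm_num) h2
    omega
  have hpd : (p : ℤ) ∣ d := (hpZ.dvd_or_dvd h).resolve_left hp2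
  have hpN : (p : ℤ) ∣ ((p * N : ℕ) : ℤ) := ⟨N, by push_cast; ring⟩
  exact hpZ.not_unit (hd.isUnit_of_dvd' hpd hpN)

/-- **`stub_pairedDoorCartan` of line `cartan-chamber`, on the NAMED published inputs** — the body
of the line's `PairedDoorCartanStatement` VERBATIM, GRANTED exactly the facts the landed k3-c3 door
`X7.kobayashiLowerDivisibility_of_paired_twist` consumes BY NAME: Kobayashi 2003 Thm 1.2 (`h12`) and
Thm 4.1 (`h41`), Pollack's signed `p`-adic `L`-functions (`hPollack`), modularity (`hmod`), the
period unit (`h5`, `h3`) and Wuthrich 2014 Lemma 20 (`hL20`). For an X7 pair `(W, p)`, `p ≥ 5`,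
`a_p = 0`, `ρ̄` onto, a Cartan discriminant `d` (only «squarefree» and «prime to `pN`» are used)
and any globally minimal model `W'` of `W^{(d)}`, the PAIRED signed lower divisibility for
`(W, W')` gives Kobayashi's lower half for `W`. CONDITIONAL on the named facts; closes nothing.
[cite: Kobayashi2003, Thm. 1.2 (p. 2), Thm. 4.1 (p. 8) and Conjecture (p. 2)]
[cite: Pollack2003, Cor. 5.11 and Prop. 6.18] [cite: SilvermanAEC2009, X.5 Cor. 5.4]
[cite: Wuthrich2014, Lemma 20 (p. 399)] -/
theorem pairedDoorCartanStatement_of_facts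
    (h12 : Kobayashi2003.thm12_signedSelmerDual_finite_torsion)
    (h41 : Kobayashi2003.thm41_signedCharIdeal_divisibility)
    (hPollack : ∀ (V : WeierstrassCurve ℚ) [V.IsElliptic] [V.IsGloballyMinimal] (p : ℕ)
      [Fact p.Prime] {N : ℕ} [NeZero N] {f : CuspForm (Gamma0 N) 2},
      pollack_exists_plusMinusPAdicLFunction (W := V) (f := f) (p := p))
    (hmod : nonempty_modularParametrizationData)
    (h5 : realPeriodRat_eq_unit_mul_plusPeriod) (h3 : realPeriodRat_eq_unit_mul_plusPeriod_three)
    (hL20 : Wuthrich2014.lemma20_surjective_threeAdic_of_semistable) :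
    ∀ (W : WeierstrassCurve ℚ) [W.IsElliptic] [W.IsGloballyMinimal] (p : ℕ) [Fact p.Prime],
      5 ≤ p → ClassX7 W p → W.frobeniusTrace p = 0 → Surj W p →
      ∀ (q : ℕ) (d : ℤ), (d < 0 ∧ Squarefree d ∧ d % 8 = 1 ∧
          IsCoprime d ((p * W.conductorNorm ℤ : ℕ) : ℤ) ∧
          IsSquare ((d : ZMod p)) ∧ ¬ IsSquare ((d : ZMod q)) ∧
          ∀ ℓ : ℕ, ℓ.Prime → ℓ ∣ W.conductorNorm ℤ → ℓ ≠ q → ℓ ≠ 2 → IsSquare ((d : ZMod ℓ))) →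
      ∀ (W' : WeierstrassCurve ℚ) [W'.IsElliptic] [W'.IsGloballyMinimal] (C : VariableChange ℚ),
        C • W' = W.quadraticTwist (d : ℚ) →
      ∀ ε : ℤˣ, PairedKobayashiLowerDivisibility W W' p ε → KobayashiLowerDivisibility W p ε := by
  intro W _ _ p _ hp5 hX hap hs q d hd W' _ _ C hC ε hpair
  have hp : p.Prime := Fact.out
  have hp2 : p ≠ 2 := by
    rintro rfl
    omega
  exact X7.kobayashiLowerDivisibility_of_paired_twist W W' p h12 h41 (hPollack W' p) hmod h5 h3 hL20
    hp2 hX hap hs hd.2.1 (not_dvd_two_mul_of_isCoprime hp hp5 hd.2.2.2.1) hC hpair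

end CartanChamber

end Summit.BirchSwinnertonDyer.BirchSwinnertonDyer.Theorems

end
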